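import Summits.Ventures.CertifiedArithmetic.LowPrec.SRPythagorasExchange
import HarnessLib

/-!
# Stochastic rounding in low-precision formats CXV — TWO random bits obey the Pythagorean law on
# EVERY tree: the two-bit law budget fed by the exchange lemma of CXIV

HONEST FRAMING: certified error envelopes and provably optimal rounding/accumulation schemes for
low-precision formats under stated cost models; every table by two implementations; no hardware or
vendor claims.

THE THEOREM (`NestedWindow.stochasticA_two_acc_sq_le`).  On every one-signed nested window
(`NestedWindow F lo hi g J`, `0 ≤ lo`; every window `[lo, hi]`, `0 ≤ lo`, of every binary format is
one, XCV `valueSet_nestedWindow`) IEEE P3109 `StochasticA` with `N = 2` random bits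
(`SR_{p,2}` of [ElararEtAl2025]; away-probability `⌊4θ⌋/4`) satisfies, for EVERY depth `J`, EVERY
`n` and EVERY unsaturated accumulation tree inside the window,

    E(ŝₙ − sₙ)² ≤ n·G²/4 + (n·G/4)²,     G = 2^J·g  (the top cell width),

the nominal Pythagorean law `n·G²/4 + (n·ε·G)²` at `ε = 2^{-N} = 1/4`.  XCIV needed `N ≥ J` bits
(drift-antitonicity; sharp for that route, XCV), CVII `N ≥` the largest binade jump, CIV settled
`N = 1` on every tree by a Bellman potential that exists only at `ε = 1/2`; for `2 ≤ N < J` every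
LOCAL budget is refuted (CX `NoiseBudget`, CXI `MeanGapLE`/`VAR-LE`, certificates gen18–gen20) and no
all-trees theorem was known.  Corollaries: every format, every nonnegative window, two bits
(`valueSet_stochasticA_two_acc_sq_le`; whole nonnegative range `…_nonneg` — XCV asked for
`emaxCode − 1` bits there: E4M3 `14`, E5M2 `29`); E3M2 `[1, 28]` (`J = 4`, `G = 4`):
`E(ŝₙ − sₙ)² ≤ 4n + n²` (`Formats.e3m2_positive_twoBits_law`); the CX witness tree `xNB` (not
drift-antitone, violates the local noise budget) is certified structurally.

THE MECHANISM.  (1) CXIV's EXCHANGE LEMMA (`deficit_pair`, every `N ≥ 1`): with `E = G/2^N` and the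
bias deficit `Def_m(t) = m·E + (E[ŝ_m | t] − (t + Σx)) ∈ [0, mE]`, at a branch point in a TOP cell
`Def(up) ≤ 3·Def(dn)` (`deficit_up_le_three_dn`), i.e. CX's drift gap obeys `Δ ≤ 2·Def(dn)`.
(2) TWO-BIT LAW BUDGET (`topNode_budget`, `lowNode_budget`): by XCI's split at both candidates
(`accExpQ_sq_split`) the law propagates up a branch point iff the node term
`π(u−c)² + (1−π)(d−c)² + 2π(u−c)·b(u) + 2(1−π)(d−c)·b(d)` is `≤ G²/4 + (2m+1)E²`.  At `N = 2`
(`E = G/4`): in a top cell (`u − d = 4E`, `π = k/4`) the term is a convex quadratic in the truncation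
error `y = c − d − 4πE ∈ [0, E)`, so it suffices to check `y = 0` and `y = E`, where it is LINEAR in
the deficits and closed by `0 ≤ Def`, `Def(up) ≤ mE` and `Def(up) ≤ 3·Def(dn)` (tight at `π = 1/2`,
`y → E`, `Def(up) = 3·Def(dn)`); in every finer cell (`u − d ≤ 2E`) it holds outright
(`(1−π)θ ≤ 1/2`).  Summing the budgets along the tree (`law_step`) is the law.

WHY ONLY `N = 2` HERE (honest scope).  The exchange lemma holds for every `N ≥ 1`, but the node budget
closes with exchange constant `3` exactly at `ε = 1/4`: with three bits the same top-cell bookkeeping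
would need `Def(up) ≤ (5/3)·Def(dn)` (the exact threshold `(2^N+2)/(2^N−2)` of the resulting linear
programme), and BOTH that inequality and the three-bit node budget FAIL on actual trees: on E3M2
`[3/8, 28]`, `s = 14`, `x = (−1921/256, −47/16, 1671/128, 639/256, −125/8, 4507/256)`, `N = 3`, the
depth-3 node in `[16, 20]` with `π = 1/2` has budget ratio `346475/344064 > 1` while the law holds
(ratio `0.34`), and with `x₃ = 845/256` the top-cell ratio is `229/133 > 5/3` (mini-certificate
`certs/sr/gen21/xnb3`, two implementations); for `N ≥ 4` the ratchet families of CX/CXIII (root drift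
gap linear in `n`) already break every node-by-node budget although the law holds there.  So no
node-wise budget proves the law for any `N ≥ 3`: the law for `3 ≤ N < J` stays OPEN (conjecture
NOISE-LE of CX) and needs a non-local argument.
One-signed windows, no saturation, as in XCIV–CXIV.  Certificate `certs/sr/gen21/twobits` (two
independent implementations, byte-identical tables, exact rational arithmetic, local, no cluster jobs;
46 665 trees = the 46 540 StochasticA trees of the gen20 census, `N = 1, 2, 3`, E3M2/FP4, adversarial
zigzag families included, + the 125 ratchet trees of CX/CXIII; 1 072 212 branch points): the two-bit
node budget has NO violation (`N = 2`: largest ratio `0.9938` in the census, `0.99961` by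
hill-climbing on synthetic nested formats, table `WITNESS`); the law holds with ratio `≤ 0.904`.
Prior art: [ElararEtAl2025, Rem. 3, Lem. 3, Thms. 3–4 (arXiv numbering)] (first-order model of
`SR_{p,r}`: bias = truncation error, mean-independent centred errors, exact-SR variance bounds);
[ConnollyHighamMary2021, Lem. 4.4–4.5, Thm. 4.8] (exact SR: mean-zero, mean-independent errors,
martingale concentration); [XiaEtAl2022]; IEEE P3109.  No all-trees MSE law for `SR_{p,r}` with fewer
bits than binades crossed was found in the literature searched (cell file FRESHNESS-SR, question Y).
-/

namespace Summit.Ventures.CertifiedArithmetic.LowPrec.SR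

open Literature.ComputerArithmetic.ConnollyHighamMary2021
open Finset

variable {K : Type*} [Field K] [LinearOrder K] [IsStrictOrderedRing K] [FloorRing K]

namespace LimitedBits

/-! ### 1. The two-bit node budgets (pure algebra) -/

omit [FloorRing K] in
set_option maxHeartbeats 800000 in
/-- **Top-cell budget for two bits.**  Cell `[d, d + 4E]` (`E = G/4`), away-probability `π = k/4`
(`k ≤ 3`) with truncation error `y = c − d − 4πE ∈ [0, E)`, child deficits `U = mE + b(up)`,
`D = mE + b(dn)` with `0 ≤ D`, `U ≤ mE` and the EXCHANGE inequality `U ≤ 3D`: the node term of the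
squared-error split is within the law increment `4E² + (2m+1)E² = G²/4 + (2m+1)(G/4)²`. -/
theorem topNode_budget {E π c d U D m : K} (hE : 0 < E) {k : ℤ} (hk0 : 0 ≤ k) (hk3 : k ≤ 3)
    (hπ : π = k / 4) (hy0 : π * (4 * E) ≤ c - d) (hy1 : c - d < π * (4 * E) + E)
    (hD0 : 0 ≤ D) (hUm : U ≤ m * E) (hUD : U ≤ 3 * D) (hm : 0 ≤ m * E) :
    π * (d + 4 * E - c) ^ 2 + (1 - π) * (d - c) ^ 2
        + 2 * π * (d + 4 * E - c) * (U - m * E) + 2 * (1 - π) * (d - c) * (D - m * E)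
      ≤ 4 * E ^ 2 + (2 * m + 1) * E ^ 2 := by
  -- slack at `y = 0` and at `y = E`, divided by `E`
  have hB0 : 0 ≤ (2 * m + 5) * E - 16 * π * (1 - π) * E - 8 * π * (1 - π) * (U - D) := by
    rcases (by omega : k = 0 ∨ k = 1 ∨ k = 2 ∨ k = 3) with rfl | rfl | rfl | rfl <;>
      norm_num at hπ <;> subst hπ <;> linarith
  have hB1 : 0 ≤ (2 * m + 5) * E - E * (π * (3 - 4 * π) ^ 2 + (1 - π) * (4 * π + 1) ^ 2)
      - 2 * π * (3 - 4 * π) * (U - m * E) + 2 * (1 - π) * (4 * π + 1) * (D - m * E) := by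
    rcases (by omega : k = 0 ∨ k = 1 ∨ k = 2 ∨ k = 3) with rfl | rfl | rfl | rfl <;>
      norm_num at hπ <;> subst hπ <;> linarith
  have hy0' : 0 ≤ c - d - π * (4 * E) := by linarith
  have hy1' : 0 ≤ E - (c - d - π * (4 * E)) := by linarith
  -- the node term is the convex quadratic `n₀ + y·L + y²`; interpolate between its endpoints
  have key : 4 * E ^ 2 + (2 * m + 1) * E ^ 2 - (π * (d + 4 * E - c) ^ 2 + (1 - π) * (d - c) ^ 2
        + 2 * π * (d + 4 * E - c) * (U - m * E) + 2 * (1 - π) * (d - c) * (D - m * E))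
      = (E - (c - d - π * (4 * E)))
            * ((2 * m + 5) * E - 16 * π * (1 - π) * E - 8 * π * (1 - π) * (U - D))
        + (c - d - π * (4 * E))
            * ((2 * m + 5) * E - E * (π * (3 - 4 * π) ^ 2 + (1 - π) * (4 * π + 1) ^ 2)
                - 2 * π * (3 - 4 * π) * (U - m * E) + 2 * (1 - π) * (4 * π + 1) * (D - m * E))
        + (c - d - π * (4 * E)) * (E - (c - d - π * (4 * E))) := by
    ring
  linarith [mul_nonneg hy1' hB0, mul_nonneg hy0' hB1, mul_nonneg hy0' hy1']

omit [FloorRing K] in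
set_option maxHeartbeats 800000 in
/-- **Finer-cell budget for two bits.**  In a cell of width `u − d ≤ 2E` (`E = G/4`) with
`π(u−d) ≤ c − d < π(u−d) + (u−d)/4` (StochasticA, two bits), `0 ≤ D` and `U ≤ mE`, the node term is
within the law increment outright: `π(1−π)w² ≤ E²`, `y² ≤ E²/4`, the `b(up)` term is `≤ 0` and
`(1−π)(c−d) ≤ (1−π)(π + 1/4)·w ≤ w/2 ≤ E`. -/
theorem lowNode_budget {E π c d u U D m : K} (hπ0 : 0 ≤ π) (hπ1 : π ≤ 1)
    (hw : u - d ≤ 2 * E) (hdc : d ≤ c) (hcu : c ≤ u)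
    (hy0 : π * (u - d) ≤ c - d) (hy1 : c - d < π * (u - d) + (u - d) / 4)
    (hD0 : 0 ≤ D) (hUm : U ≤ m * E) (hm : 0 ≤ m * E) :
    π * (u - c) ^ 2 + (1 - π) * (d - c) ^ 2
        + 2 * π * (u - c) * (U - m * E) + 2 * (1 - π) * (d - c) * (D - m * E)
      ≤ 4 * E ^ 2 + (2 * m + 1) * E ^ 2 := by
  have hw0 : 0 ≤ u - d := by linarith
  have hE : 0 ≤ E := by linarith
  have hsplit : π * (u - c) ^ 2 + (1 - π) * (d - c) ^ 2
        + 2 * π * (u - c) * (U - m * E) + 2 * (1 - π) * (d - c) * (D - m * E)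
      = π * (1 - π) * (u - d) ^ 2 + (c - d - π * (u - d)) ^ 2
        - 2 * (π * (u - c) * (m * E - U)) + 2 * ((1 - π) * (c - d) * (m * E - D)) := by ring
  have h1 : π * (1 - π) ≤ 1 / 4 := by linarith [sq_nonneg (π - 1 / 2)]
  have h2 : (u - d) ^ 2 ≤ (2 * E) ^ 2 := pow_le_pow_left₀ hw0 hw 2
  have ha : π * (1 - π) * (u - d) ^ 2 ≤ E ^ 2 := by
    have := mul_le_mul h1 h2 (sq_nonneg _) (by norm_num)
    linarith
  have hb : (c - d - π * (u - d)) ^ 2 ≤ E ^ 2 / 4 := by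
    have hy : c - d - π * (u - d) ≤ E / 2 := by linarith
    have hy' : 0 ≤ c - d - π * (u - d) := by linarith
    have hE2 : (0 : K) ≤ E / 2 := by linarith
    linarith [mul_nonneg hy' (sub_nonneg.mpr hy), mul_nonneg (sub_nonneg.mpr hy) hE2]
  have hc : 0 ≤ π * (u - c) * (m * E - U) :=
    mul_nonneg (mul_nonneg hπ0 (by linarith)) (by linarith)
  have h3 : (1 - π) * (π + 1 / 4) ≤ 1 / 2 := by linarith [sq_nonneg (π - 3 / 8)]
  have hd0 : 0 ≤ (1 - π) * (c - d) := mul_nonneg (by linarith) (by linarith)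
  have hd1 : (1 - π) * (c - d) ≤ E := by
    have e1 : (1 - π) * (c - d) ≤ (1 - π) * ((π + 1 / 4) * (u - d)) :=
      mul_le_mul_of_nonneg_left (by linarith) (by linarith)
    have e2 : (1 - π) * ((π + 1 / 4) * (u - d)) ≤ 1 / 2 * (u - d) := by
      rw [← mul_assoc]; exact mul_le_mul_of_nonneg_right h3 hw0
    linarith
  have hd2 : (1 - π) * (c - d) * (m * E - D) ≤ E * (m * E) := by
    have e1 : (1 - π) * (c - d) * (m * E - D) ≤ (1 - π) * (c - d) * (m * E) := by
      linarith [mul_nonneg hd0 hD0]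
    exact e1.trans (mul_le_mul_of_nonneg_right hd1 hm)
  have hE2 : 0 ≤ E ^ 2 := sq_nonneg E
  have hmE2 : 0 ≤ E * (m * E) := mul_nonneg hE hm
  rw [hsplit]
  linarith [ha, hb, hc, hd2]

omit [FloorRing K] in
/-- The law propagates up a branch point: XCI's split at both candidates, the convex combination of
the subtree laws, and the node budget. -/
theorem law_step {π Xu Xd Mu Md bu bd A B u d c L I : K}
    (hsu : Xu = Mu + 2 * (u - c) * bu + (u - c) ^ 2) (hsd : Xd = Md + 2 * (d - c) * bd + (d - c) ^ 2)
    (hbu : bu = A) (hbd : bd = B) (hp0 : 0 ≤ π) (hp1 : π ≤ 1) (hMu : Mu ≤ L) (hMd : Md ≤ L)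
    (hnode : π * (u - c) ^ 2 + (1 - π) * (d - c) ^ 2 + 2 * π * (u - c) * A + 2 * (1 - π) * (d - c) * B
      ≤ I) :
    π * Xu + (1 - π) * Xd ≤ L + I := by
  subst hsu hsd hbu hbd
  linarith [mul_le_mul_of_nonneg_left hMu hp0, mul_le_mul_of_nonneg_left hMd (sub_nonneg.mpr hp1)]

namespace NestedWindow

variable {F : Finset K} {lo hi g : K} {J : ℕ}

/-! ### 2. The two-bit Pythagorean law on every tree -/

set_option maxHeartbeats 1600000 in
/-- **TWO RANDOM BITS OBEY THE PYTHAGOREAN LAW ON EVERY TREE.**  On a one-signed nested window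
(`0 ≤ lo`, any depth `J`), every unsaturated StochasticA accumulation with `N = 2` random bits
satisfies `E(ŝₙ − sₙ)² ≤ n·G²/4 + (n·G/4)²`, `G = 2^J·g`, for every `n`. -/
theorem stochasticA_two_acc_sq_le (hW : NestedWindow F lo hi g J) (hlo : 0 ≤ lo) (x : ℕ → K) (n : ℕ)
    (s : K) (hns : NoSat F x n s) (hw : InWindow F lo hi x n s) :
    accExpQ F (probAwayA 2) x n (fun t => (t - (s + ∑ i ∈ range n, x i)) ^ 2) s
      ≤ n * ((2 ^ J * g) ^ 2 / 4) + (n * (1 / 2 ^ 2 * (2 ^ J * g))) ^ 2 := by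
  have hg := hW.pos
  have hF : F.Nonempty := ⟨lo, hW.lo_mem⟩
  set G : K := 2 ^ J * g with hG
  set E : K := G / 4 with hE
  have hEp : 0 < E := by positivity
  revert s
  induction n generalizing x with
  | zero => intro s _ _; simp [accExpQ]
  | succ n ih =>
    rintro s ⟨hin, hnu, hnd⟩ ⟨⟨h1, h2⟩, hwu, hwd⟩
    rw [clamp_eq_self hin] at h1 h2
    have hsum : s + ∑ i ∈ range (n + 1), x i = (s + x 0) + ∑ i ∈ range n, x (i + 1) := by
      rw [Finset.sum_range_succ']; ring
    simp only [hsum]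
    show stepQ F (probAwayA 2) (s + x 0) (accExpQ F (probAwayA 2) (fun i => x (i + 1)) n
      (fun t => (t - ((s + x 0) + ∑ i ∈ range n, x (i + 1))) ^ 2)) ≤ _
    obtain ⟨hdF, huF, hlod, huhi, hdc, hcu⟩ := hW.cand h1 h2
    set c := s + x 0 with hc
    set x' : ℕ → K := fun i => x (i + 1) with hx'
    set S' : K := ∑ i ∈ range n, x' i with hS'
    obtain ⟨hp0, hp1⟩ := pUpQ_mem F (probAwayA_mem 2) c
    have hnE : (n : K) * (2 ^ J * g / 2 ^ 2) = n * E := by rw [hE, hG]; norm_num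
    have hmE : 0 ≤ (n : K) * E := by positivity
    -- the deficits of the two subtrees
    set U := deficit F 2 G x' n (up F c) with hU
    set D := deficit F 2 G x' n (dn F c) with hD
    have hDu : 0 ≤ U ∧ U ≤ n * E := by
      have h := hW.deficit_nonneg_le hlo 2 x' n (up F c) hnu hwu
      rw [hnE] at h; exact h
    have hDd : 0 ≤ D ∧ D ≤ n * E := by
      have h := hW.deficit_nonneg_le hlo 2 x' n (dn F c) hnd hwd
      rw [hnE] at h; exact h
    have hbu : accExpQ F (probAwayA 2) x' n (fun y => y) (up F c) - (up F c + S') = U - n * E := by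
      simp only [hU, deficit, hE, hG, hS']; ring
    have hbd : accExpQ F (probAwayA 2) x' n (fun y => y) (dn F c) - (dn F c + S') = D - n * E := by
      simp only [hD, deficit, hE, hG, hS']; ring
    -- the node budget
    have hnode : pUpQ F (probAwayA 2) c * (up F c - c) ^ 2 + (1 - pUpQ F (probAwayA 2) c) * (dn F c - c) ^ 2
        + 2 * pUpQ F (probAwayA 2) c * (up F c - c) * (U - n * E)
        + 2 * (1 - pUpQ F (probAwayA 2) c) * (dn F c - c) * (D - n * E)
        ≤ 4 * E ^ 2 + (2 * n + 1) * E ^ 2 := by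
      have hUD : up F c - dn F c = 2 ^ J * g → U ≤ 3 * D := fun htop =>
        hW.deficit_up_le_three_dn hlo (N := 2) (by norm_num) x' n htop hnu hwu hnd hwd
      clear_value U D
      clear hbu hbd hU hD ih
      have hinc : 0 ≤ 4 * E ^ 2 + (2 * (n : K) + 1) * E ^ 2 := by positivity
      by_cases hne : up F c = dn F c
      · -- exact branch point: no node term
        have hcd : c ≤ dn F c := by rw [← hne]; exact hcu
        have e1 : up F c - c = 0 := by rw [hne]; linarith
        have e2 : dn F c - c = 0 := by linarith
        rw [e1, e2]
        linarith [hinc]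
      · obtain ⟨j, hj, hwj, hτ, hβ0, hβlt⟩ := hW.cellA hlo 2 h1 h2 hne
        -- `τ(c) − ⌊c̄⌋ = π·w`
        have hπw : stepQ F (probAwayA 2) c (fun y => y) - dn F c
            = pUpQ F (probAwayA 2) c * (up F c - dn F c) := by
          simp only [stepQ]; ring
        rcases Nat.lt_or_ge j J with hjlt | hjge
        · -- finer cell: `w ≤ 2E`
          have hw2 : up F c - dn F c ≤ 2 * E := by
            have h2j : (2 : K) ^ j * 2 ≤ 2 ^ J := by
              rw [← pow_succ]; exact pow_le_pow_right₀ (by norm_num) (by omega)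
            have := mul_le_mul_of_nonneg_right h2j hg.le
            rw [hwj, hE, hG]; linarith
          have hy0 : pUpQ F (probAwayA 2) c * (up F c - dn F c) ≤ c - dn F c := by
            linarith [hπw, hβ0]
          have hy1 : c - dn F c < pUpQ F (probAwayA 2) c * (up F c - dn F c) + (up F c - dn F c) / 4 := by
            have e : (2 : K) ^ j * g / 2 ^ 2 = (up F c - dn F c) / 4 := by rw [hwj]; norm_num
            rw [e] at hβlt; linarith [hπw, hβlt]
          exact lowNode_budget hp0 hp1 hw2 hdc hcu hy0 hy1 hDd.1 hDu.2 hmE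
        · -- top cell: `w = 4E`, `π = k/4`, exchange inequality `U ≤ 3D`
          have hjJ : j = J := le_antisymm hj hjge
          rw [hjJ] at hwj hτ hβlt
          have hUD := hUD hwj
          have hu : up F c = dn F c + 4 * E := by rw [hE, hG]; linarith
          have hρE : (2 : K) ^ J * g / 2 ^ 2 = E := by rw [hE, hG]; norm_num
          rw [hρE] at hτ hβlt
          set k : ℤ := ⌊(c - dn F c) / E⌋ with hk
          have e1 : stepQ F (probAwayA 2) c (fun y => y) - dn F c = E * k := by
            rw [hk, hτ]; simp only [resid]; ring
          have hπw' := hπw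
          rw [hu] at hπw'
          have hπk : pUpQ F (probAwayA 2) c * (4 * E) = k * E := by linear_combination e1 - hπw'
          have hπ' : pUpQ F (probAwayA 2) c = k / 4 := by
            have h4 : pUpQ F (probAwayA 2) c * 4 = k := mul_right_cancel₀ hEp.ne' (by linarith [hπk])
            rw [eq_div_iff (by norm_num : (4 : K) ≠ 0)]; exact h4
          have hk0 : 0 ≤ k := by
            rw [hk]; exact Int.floor_nonneg.mpr (div_nonneg (by linarith) hEp.le)
          have hcu' : c < up F c := by
            rcases eq_or_lt_of_le hcu with h | h
            · exact absurd (le_antisymm (le_dn_of_mem huF (le_of_eq h.symm)) (dn_le_up F c)) hne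
            · exact h
          have hk3 : k ≤ 3 := by
            have hlt4 : (k : K) < 4 := by
              have h3 : (k : K) * E ≤ c - dn F c := by
                have := Int.floor_le ((c - dn F c) / E)
                rw [hk]; rwa [le_div_iff₀ hEp] at this
              by_contra hge
              have : 4 * E ≤ (k : K) * E := mul_le_mul_of_nonneg_right (not_lt.mp hge) hEp.le
              linarith
            have : k < 4 := by exact_mod_cast hlt4
            omega
          have hy0 : pUpQ F (probAwayA 2) c * (4 * E) ≤ c - dn F c := by linarith [hπw', hβ0]
          have hy1 : c - dn F c < pUpQ F (probAwayA 2) c * (4 * E) + E := by linarith [hπw', hβlt]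
          have := topNode_budget (c := c) (d := dn F c) hEp hk0 hk3 hπ' hy0 hy1 hDd.1 hDu.2 hUD hmE
          rw [hu]; exact this
    -- the subtrees' laws (induction hypothesis), the split, and the assembly of the step
    have IHu : accExpQ F (probAwayA 2) x' n (fun y => (y - (up F c + S')) ^ 2) (up F c)
        ≤ n * (G ^ 2 / 4) + (n * (1 / 2 ^ 2 * G)) ^ 2 := ih x' (up F c) hnu hwu
    have IHd : accExpQ F (probAwayA 2) x' n (fun y => (y - (dn F c + S')) ^ 2) (dn F c)
        ≤ n * (G ^ 2 / 4) + (n * (1 / 2 ^ 2 * G)) ^ 2 := ih x' (dn F c) hnd hwd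
    have hlaw : (n * (G ^ 2 / 4) + (n * (1 / 2 ^ 2 * G)) ^ 2) + (4 * E ^ 2 + (2 * n + 1) * E ^ 2)
        = ((n + 1 : ℕ) : K) * (G ^ 2 / 4) + ((n + 1 : ℕ) * (1 / 2 ^ 2 * G)) ^ 2 := by
      rw [hE]; push_cast; ring
    have hsu := accExpQ_sq_split F (probAwayA 2) x' n (up F c) S' c
    have hsd := accExpQ_sq_split F (probAwayA 2) x' n (dn F c) S' c
    simp only [stepQ]
    exact (law_step hsu hsd hbu hbd hp0 hp1 IHu IHd hnode).trans_eq hlaw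

end NestedWindow

/-! ### 3. Every format, every nonnegative window, two bits -/

section Formats

open Literature.ComputerArithmetic.FloatingPoint (Format MiniFloat)
open Literature.ComputerArithmetic.FloatingPoint.MiniFloat (valueSet valueSet_nonempty)

/-- **Two bits, every format, every nonnegative window.**  For values `0 ≤ lo ≤ hi` of `φ`, every
StochasticA accumulation with TWO random bits confined to `[lo, hi]` (no saturation) satisfies, for
every `n`, `E(ŝₙ − sₙ)² ≤ n·G²/4 + (n·G/4)²` with `G = 2^{binadeIdx hi}·quantum` — no bit threshold
(XCV asked for `N ≥ binadeIdx hi − binadeIdx lo`). -/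
theorem valueSet_stochasticA_two_acc_sq_le (φ : Format) {lo hi : ℚ} (hlo : lo ∈ valueSet φ)
    (hhi : hi ∈ valueSet φ) (h0 : 0 ≤ lo) (hle : lo ≤ hi) (x : ℕ → ℚ) (n : ℕ) (s : ℚ)
    (hns : NoSat (valueSet φ) x n s) (hw : InWindow (valueSet φ) lo hi x n s) :
    accExpQ (valueSet φ) (probAwayA 2) x n (fun t => (t - (s + ∑ i ∈ range n, x i)) ^ 2) s
      ≤ n * ((2 ^ binadeIdx φ hi * φ.quantum) ^ 2 / 4)
        + (n * (1 / 2 ^ 2 * (2 ^ binadeIdx φ hi * φ.quantum))) ^ 2 := by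
  have h := (valueSet_nestedWindow φ hlo hhi h0).stochasticA_two_acc_sq_le h0 x n s hns hw
  have e : (2 : ℚ) ^ (binadeIdx φ hi - binadeIdx φ lo) * (2 ^ binadeIdx φ lo * φ.quantum)
      = 2 ^ binadeIdx φ hi * φ.quantum := by
    rw [← mul_assoc, ← pow_add, Nat.sub_add_cancel (binadeIdx_mono φ hle)]
  rwa [e] at h

/-- **Two bits, whole nonnegative range, every format.**  Every StochasticA accumulation with TWO
random bits confined to `[0, maxRat]` obeys the law with `G = 2^{emaxCode−1}·quantum` (the top
spacing), for every `n` — where XCV's drift-antitone route needs `emaxCode − 1` bits (E4M3 `14`,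
E5M2 `29`, binary16 `29`). -/
theorem valueSet_stochasticA_two_acc_sq_le_nonneg (φ : Format) (x : ℕ → ℚ) (n : ℕ) (s : ℚ)
    (hns : NoSat (valueSet φ) x n s) (hw : InWindow (valueSet φ) 0 φ.maxRat x n s) :
    accExpQ (valueSet φ) (probAwayA 2) x n (fun t => (t - (s + ∑ i ∈ range n, x i)) ^ 2) s
      ≤ n * ((2 ^ (φ.emaxCode - 1) * φ.quantum) ^ 2 / 4)
        + (n * (1 / 2 ^ 2 * (2 ^ (φ.emaxCode - 1) * φ.quantum))) ^ 2 := by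
  have hq := φ.quantum_pos
  have h0mem : (0 : ℚ) ∈ valueSet φ := MiniFloat.mem_valueSet.mpr ⟨MiniFloat.zero φ, MiniFloat.toRat_zero⟩
  have htop : binadeIdx φ φ.maxRat ≤ φ.emaxCode - 1 := Format.shift_le _
  have h := valueSet_stochasticA_two_acc_sq_le φ h0mem (MiniFloat.maxRat_mem_valueSet φ) le_rfl
    (mul_nonneg (by positivity) φ.quantum_pos.le) x n s hns hw
  refine h.trans ?_
  have hG : (2 : ℚ) ^ binadeIdx φ φ.maxRat * φ.quantum ≤ 2 ^ (φ.emaxCode - 1) * φ.quantum :=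
    mul_le_mul_of_nonneg_right (pow_le_pow_right₀ (by norm_num) htop) φ.quantum_pos.le
  have hG0 : (0 : ℚ) ≤ 2 ^ binadeIdx φ φ.maxRat * φ.quantum := mul_nonneg (by positivity) hq.le
  gcongr

end Formats

end LimitedBits

/-! ### 4. Kernel-checked instances on E3M2 -/

namespace Formats

open LimitedBits
open Literature.ComputerArithmetic.FloatingPoint (Format)

/-- **E3M2, the whole positive range `[1, 28]` (`J = 4`, `G = 4`), two bits**: every unsaturated
StochasticA accumulation inside it satisfies `E(ŝₙ − sₙ)² ≤ 4n + n²` for every `n` (CVI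
`e3m2_nested_1_28`; XCIV's threshold there is four bits, CVII's the largest jump). -/
theorem e3m2_positive_twoBits_law (x : ℕ → ℚ) (n : ℕ) (s : ℚ) (hns : NoSat e3m2 x n s)
    (hw : InWindow e3m2 1 28 x n s) :
    accExpQ e3m2 (probAwayA 2) x n (fun t => (t - (s + ∑ i ∈ range n, x i)) ^ 2) s ≤ 4 * n + n ^ 2 :=
  (e3m2_nested_1_28.stochasticA_two_acc_sq_le (by norm_num) x n s hns hw).trans (le_of_eq (by ring))

/-- The E3M2 window `[1, 12]` (spacings `1/4, 1/2, 1, 2`) is nested with `g = 1/4`, `J = 3`. -/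
theorem e3m2_nested_1_12 : NestedWindow e3m2 1 12 (1 / 4) 3 := by
  have h := valueSet_nestedWindow Format.E3M2 (lo := 1) (hi := 12)
    (by rw [← e3m2_eq_valueSet]; decide +kernel) (by rw [← e3m2_eq_valueSet]; decide +kernel) (by norm_num)
  have h1 : binadeIdx Format.E3M2 1 = 2 := by decide +kernel
  have h2 : binadeIdx Format.E3M2 12 = 5 := by decide +kernel
  have hq : Format.E3M2.quantum = 1 / 16 := by decide +kernel
  rw [h1, h2, hq, ← e3m2_eq_valueSet] at h
  norm_num at h
  exact h

/-- **CX's witness tree is certified structurally.**  E3M2, two bits, from `2` add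
`57/8, −53/8, 113/16` inside `[1, 12]` (`J = 3 > N = 2`, `G = 2`): NOT drift-antitone and violating the
local noise budget (CX `e3m2_noiseBudget_fails_noiseQ_le`, where the law was obtained from the
per-tree evaluation `𝒩 ≤ 3·G²/4`); the two-bit theorem gives `E(ŝ₃ − s₃)² ≤ 3·G²/4 + (3·G/4)² = 21/4`
with no evaluation of the tree (actual value `439/256`). -/
theorem e3m2_xNB_twoBits_structural :
    ¬ DriftAntitone e3m2 (probAwayA 2) xNB 3 2 ∧ ¬ NoiseBudget e3m2 (probAwayA 2) 2 xNB 3 2 ∧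
    accExpQ e3m2 (probAwayA 2) xNB 3 (fun t => (t - (2 + ∑ i ∈ range 3, xNB i)) ^ 2) 2 ≤ 21 / 4 := by
  obtain ⟨hw, hns, -, hda, hnb, -⟩ := e3m2_noiseBudget_fails_noiseQ_le
  exact ⟨hda, hnb, (e3m2_nested_1_12.stochasticA_two_acc_sq_le (by norm_num) xNB 3 2 hns hw).trans
    (le_of_eq (by norm_num))⟩

end Formats

end Summit.Ventures.CertifiedArithmetic.LowPrec.SR
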